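import Summits.Ventures.LatticeQCDFlow.Scaling.HubClassGlobalStartContentAbove
import Summits.Ventures.LatticeQCDFlow.Scaling.TaggedCostSideDeep

/-!
HONEST FRAMING: exact (Metropolis-corrected) sampling algorithms for lattice gauge theory; figures
of merit are autocorrelation/cost numbers at stated couplings and volumes; no continuum-physics
claim.

# TaggedStartContentAboveGlobal — THE START-CONTENT DEFICIT FOR W26'S TAGGED CHAINS OF AN ARBITRARY ADJACENT PAIR FROM A HUB AT OR ABOVE THE MORE PERSISTENT EXTRA PARTICLE
# (`W_a ≤ W_z`, THE TIE INCLUDED; PRESENT CONTENTS BETWEEN THE EXTRA PARTICLES ALLOWED): NO DEFICIT WITH A THIRD PARTICLE AT OR ABOVE `W_a`; ALWAYS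
# `y_{n+1}(z) − x_{n+1}(z) ≤ 𝟙{n even}K^{−(n+1)}/2`, `y_1(z) ≤ x_1(z)`, AND `Σ_{n<J}(1−σ)σⁿ(y_{n+1}(z)−x_{n+1}(z))⁺ ≤ (1−σ)·½·(1/K)·(σ/K)²/(1−σ²/K²)` (lean-2 GEN-42, ours)

Venture-side (OURS).  Cell `lqcd-flow` (pub-lqcd), unit `pub-lqcd-lean-2-g42`, 2026-08-30.  Chapter AB (route (β), the cost side continued), file 9 = file 8 moved to the tagged hub
chains (chapter W's data on `Option S`, Z4 `tagged_kernel_eq`, as in file 5) and integrated.  GEN-41 file 6 (C) ∕ (D) needed «no present content strictly between `W_b` and `W_a`»,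
`W_a < W_z` strictly and, for (D), every other content strictly below `W_b`; HERE: any contents between, `W_a ≤ W_z`, and the dichotomy of file 8 covers the ties.  The pair
`W_b = W_a` is the trivial case `P_X = P_Y`.

* `budget_evenPos_le` (`Σ_{n<J, n even, n≠0}tⁿ ≤ t²/(1−t²)`), `tagged_laws_eq_of_tags_eq` (`W_a = W_b ⇒ x_n = y_n`),
  **`tagged_startClass_above_global`**: (i) `N_C(z) ≥ 2` or a present `w ≠ z` with `W_a ≤ W_w` ⇒ `y_n(z) ≤ x_n(z)` for all `n`; (ii) `y_{n+1}(z) − x_{n+1}(z) ≤ 𝟙{n even}K^{−(n+1)}/2`;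
  (iii) `y_1(z) ≤ x_1(z)`; (iv) the discounted budget `(1−σ)·(1/(1+1))·(1/K)·((σ/K)²/(1−(σ/K)²))` (the form GEN-41 file 10's `costSide_scalar_above` consumes with `t = 1`).

File 10 pays (iv) with GEN-41 file 10's income when no third particle sits at or above `W_a`, and needs nothing otherwise: Conjecture W′ for hubs at or above `W_a` on every edge.
Literature grade (cell rule): OWN; nothing cited; no new bib keys.
-/

open Finset

namespace Summit.Ventures.LatticeQCDFlow.Scaling

/-! ### §1 Two small tools -/
section AboveTools

/-- `Σ_{n<J, n even, n ≠ 0} tⁿ ≤ t²/(1−t²)` for `0 ≤ t < 1` (GEN-41 file 9's summation, isolated). [ours] -/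
theorem budget_evenPos_le {t : ℝ} (ht0 : 0 ≤ t) (ht1 : t < 1) (J : ℕ) :
    ∑ n ∈ range J, (if Even n ∧ n ≠ 0 then t ^ n else 0) ≤ t ^ 2 / (1 - t ^ 2) := by
  have h1 : 0 < 1 - t ^ 2 := by nlinarith
  rcases Nat.eq_zero_or_pos J with hJ | hJ
  · subst hJ; rw [sum_range_zero]; exact div_nonneg (pow_nonneg ht0 2) h1.le
  · have hsplit : ∑ n ∈ range J, (if Even n then t ^ n else 0) = 1 + ∑ n ∈ range J, (if Even n ∧ n ≠ 0 then t ^ n else 0) := by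
      have hpt : ∀ n, (if Even n then t ^ n else (0:ℝ)) = (if Even n ∧ n ≠ 0 then t ^ n else 0) + (if n = 0 then (1:ℝ) else 0) := by
        intro n; by_cases h0 : n = 0
        · subst h0; simp
        · simp [h0]
      rw [sum_congr rfl fun n _ => hpt n, sum_add_distrib, sum_ite_eq' (range J) 0, if_pos (mem_range.mpr hJ)]; ring
    have hle := budget_evenGeom_le ht0 ht1 J
    rw [hsplit] at hle
    have h2 := (le_div_iff₀ h1).mp hle
    rw [le_div_iff₀ h1]
    have h3 : (∑ n ∈ range J, (if Even n ∧ n ≠ 0 then t ^ n else (0:ℝ))) * (1 - t ^ 2)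
        = (1 + ∑ n ∈ range J, (if Even n ∧ n ≠ 0 then t ^ n else (0:ℝ))) * (1 - t ^ 2) - (1 - t ^ 2) := by ring
    rw [h3]; linarith

end AboveTools

/-! ### §2 The tagged chains of an arbitrary adjacent pair, hub at or above `W_a` -/
section TaggedAbove
variable {S : Type*} [Fintype S] [DecidableEq S]
variable {W : S → ℝ} {acc : S → S → ℝ} {K : ℕ} {NC : S → ℕ} {a b : S} {PX PY : Option S → Option S → ℝ}

/-- **Equal tags give equal laws:** `W_a = W_b` ⇒ `x_n = y_n`. [ours] -/
theorem tagged_laws_eq_of_tags_eq (hacc : ∀ h v, acc h v = min 1 (W h / W v)) (hba : W b = W a)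
    (hPXoff : ∀ h v, h ≠ v → PX (some h) (some v) = if NC h = 0 then 0 else (NC v : ℝ) / K * acc h v)
    (hPXin : ∀ h, PX (some h) none = if NC h = 0 then 0 else acc h a / K)
    (hPXdiag : ∀ h, PX (some h) (some h) = 1 - (∑ v ∈ univ.erase h, PX (some h) (some v) + PX (some h) none))
    (hPXout : ∀ v, PX none (some v) = (NC v : ℝ) / K * acc a v) (hPXstay : PX none none = 1 - ∑ v, PX none (some v))
    (hPYoff : ∀ h v, h ≠ v → PY (some h) (some v) = if NC h = 0 then 0 else (NC v : ℝ) / K * acc h v)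
    (hPYin : ∀ h, PY (some h) none = if NC h = 0 then 0 else acc h b / K)
    (hPYdiag : ∀ h, PY (some h) (some h) = 1 - (∑ v ∈ univ.erase h, PY (some h) (some v) + PY (some h) none))
    (hPYout : ∀ v, PY none (some v) = (NC v : ℝ) / K * acc b v) (hPYstay : PY none none = 1 - ∑ v, PY none (some v))
    {z : S} {x y : ℕ → Option S → ℝ}
    (hx0 : ∀ v, x 0 v = if v = some z then 1 else 0) (hxs : ∀ n v, x (n + 1) v = ∑ h, x n h * PX h v)
    (hy0 : ∀ v, y 0 v = if v = some z then 1 else 0) (hys : ∀ n v, y (n + 1) v = ∑ h, y n h * PY h v) :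
    ∀ n v, x n v = y n v := by
  have hacc_a : ∀ h, acc h a = acc h b := fun h => by rw [hacc, hacc, hba]
  have hacc_a' : ∀ v, acc a v = acc b v := fun v => by rw [hacc, hacc, hba]
  have hP : ∀ h v, PX h v = PY h v := by
    intro h v
    rcases h with _ | h <;> rcases v with _ | v
    · rw [hPXstay, hPYstay]; congr 1; exact sum_congr rfl fun v _ => by rw [hPXout, hPYout, hacc_a']
    · rw [hPXout, hPYout, hacc_a']
    · rw [hPXin, hPYin, hacc_a]
    · by_cases hhv : h = v
      · subst hhv
        rw [hPXdiag, hPYdiag, hPXin, hPYin, hacc_a]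
        congr 2
        exact sum_congr rfl fun v hv => by rw [hPXoff h v (ne_of_mem_erase hv).symm, hPYoff h v (ne_of_mem_erase hv).symm]
      · rw [hPXoff h v hhv, hPYoff h v hhv]
  intro n
  induction n with
  | zero => intro v; rw [hx0, hy0]
  | succ n ih => intro v; rw [hxs, hys]; exact sum_congr rfl fun h _ => by rw [ih, hP]

/-- **THE START-CONTENT DEFICIT FROM A HUB AT OR ABOVE `W_a`, ARBITRARY ADJACENT PAIR** (see the module docstring). [ours] -/
theorem tagged_startClass_above_global (hW : ∀ v, 0 < W v) (hacc : ∀ h v, acc h v = min 1 (W h / W v)) (hK : 2 ≤ K) (hNC : ∑ v, NC v = K) (hab : W b ≤ W a)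
    (hPXoff : ∀ h v, h ≠ v → PX (some h) (some v) = if NC h = 0 then 0 else (NC v : ℝ) / K * acc h v)
    (hPXin : ∀ h, PX (some h) none = if NC h = 0 then 0 else acc h a / K)
    (hPXdiag : ∀ h, PX (some h) (some h) = 1 - (∑ v ∈ univ.erase h, PX (some h) (some v) + PX (some h) none))
    (hPXout : ∀ v, PX none (some v) = (NC v : ℝ) / K * acc a v) (hPXstay : PX none none = 1 - ∑ v, PX none (some v))
    (hPYoff : ∀ h v, h ≠ v → PY (some h) (some v) = if NC h = 0 then 0 else (NC v : ℝ) / K * acc h v)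
    (hPYin : ∀ h, PY (some h) none = if NC h = 0 then 0 else acc h b / K)
    (hPYdiag : ∀ h, PY (some h) (some h) = 1 - (∑ v ∈ univ.erase h, PY (some h) (some v) + PY (some h) none))
    (hPYout : ∀ v, PY none (some v) = (NC v : ℝ) / K * acc b v) (hPYstay : PY none none = 1 - ∑ v, PY none (some v))
    {z : S} (hz : NC z ≠ 0) (haz : W a ≤ W z)
    {x y : ℕ → Option S → ℝ}
    (hx0 : ∀ v, x 0 v = if v = some z then 1 else 0) (hxs : ∀ n v, x (n + 1) v = ∑ h, x n h * PX h v)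
    (hy0 : ∀ v, y 0 v = if v = some z then 1 else 0) (hys : ∀ n v, y (n + 1) v = ∑ h, y n h * PY h v) :
    ((2 ≤ NC z ∨ ∃ w, w ≠ z ∧ NC w ≠ 0 ∧ W a ≤ W w) → ∀ n, y n (some z) ≤ x n (some z))
      ∧ (∀ n, y (n + 1) (some z) - x (n + 1) (some z) ≤ if Even n then (1 / (K : ℝ)) ^ (n + 1) / 2 else 0)
      ∧ y 1 (some z) ≤ x 1 (some z)
      ∧ (∀ σ : ℝ, 0 ≤ σ → σ < 1 → ∀ J, ∑ n ∈ range J, (1 - σ) * σ ^ n * max 0 (y (n + 1) (some z) - x (n + 1) (some z))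
          ≤ (1 - σ) * ((1 : ℝ) / (1 + 1) * (1 / (K : ℝ)) * ((σ * (1 / (K : ℝ))) ^ 2 / (1 - (σ * (1 / (K : ℝ))) ^ 2)))) := by
  have hK1 : 1 ≤ K := by omega
  have hK0 : (0 : ℝ) < K := by exact_mod_cast (show 0 < K by omega)
  have hK2 : (2 : ℝ) ≤ K := by exact_mod_cast hK
  -- the first three statements
  have main : ((2 ≤ NC z ∨ ∃ w, w ≠ z ∧ NC w ≠ 0 ∧ W a ≤ W w) → ∀ n, y n (some z) ≤ x n (some z))
      ∧ (∀ n, y (n + 1) (some z) - x (n + 1) (some z) ≤ if Even n then (1 / (K : ℝ)) ^ (n + 1) / 2 else 0)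
      ∧ y 1 (some z) ≤ x 1 (some z) := by
    rcases eq_or_lt_of_le hab with hba | hba
    · -- `W_b = W_a`: the two chains coincide
      have hxy := tagged_laws_eq_of_tags_eq hacc hba hPXoff hPXin hPXdiag hPXout hPXstay hPYoff hPYin hPYdiag hPYout hPYstay hx0 hxs hy0 hys (z := z)
      refine ⟨fun _ n => by rw [hxy], fun n => ?_, by rw [hxy]⟩
      rw [hxy, sub_self]
      split_ifs
      · positivity
      · exact le_rfl
    · -- `W_b < W_a`: file 8 on chapter W's data over `Option S` (verbatim from file 5)
      classical
      -- chapter W's data on the content type `Option S` (verbatim from Z12 ∕ GEN-41 file 6)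
      obtain ⟨N', hN'⟩ : ∃ N' : Option S → ℕ, ∀ o, N' o = Option.elim o 1 NC := ⟨_, fun _ => rfl⟩
      obtain ⟨WX', hWX'⟩ : ∃ W' : Option S → ℝ, ∀ o, W' o = Option.elim o (W a) W := ⟨_, fun _ => rfl⟩
      obtain ⟨WY', hWY'⟩ : ∃ W' : Option S → ℝ, ∀ o, W' o = Option.elim o (W b) W := ⟨_, fun _ => rfl⟩
      obtain ⟨accX', haccX'⟩ : ∃ acc' : Option S → Option S → ℝ, ∀ h v, acc' h v = min 1 (WX' h / WX' v) := ⟨_, fun _ _ => rfl⟩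
      obtain ⟨accY', haccY'⟩ : ∃ acc' : Option S → Option S → ℝ, ∀ h v, acc' h v = min 1 (WY' h / WY' v) := ⟨_, fun _ _ => rfl⟩
      obtain ⟨offX, hoffX⟩ : ∃ off : (Option S → ℕ) → Option S → Option S → ℝ, ∀ M h v, off M h v = if M h = 0 then 0 else (M v : ℝ) / K * accX' h v :=
        ⟨_, fun _ _ _ => rfl⟩
      obtain ⟨offY, hoffY⟩ : ∃ off : (Option S → ℕ) → Option S → Option S → ℝ, ∀ M h v, off M h v = if M h = 0 then 0 else (M v : ℝ) / K * accY' h v :=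
        ⟨_, fun _ _ _ => rfl⟩
      obtain ⟨KhX, hKhX⟩ : ∃ Kh : (Option S → ℕ) → Option S → Option S → ℝ, ∀ M h v, Kh M h v = if h = v then 1 - ∑ v' ∈ univ.erase h, offX M h v' else offX M h v :=
        ⟨_, fun _ _ _ => rfl⟩
      obtain ⟨KhY, hKhY⟩ : ∃ Kh : (Option S → ℕ) → Option S → Option S → ℝ, ∀ M h v, Kh M h v = if h = v then 1 - ∑ v' ∈ univ.erase h, offY M h v' else offY M h v :=
        ⟨_, fun _ _ _ => rfl⟩
      have hKXoff : ∀ M h v, h ≠ v → KhX M h v = if M h = 0 then 0 else (M v : ℝ) / K * min 1 (WX' h / WX' v) := fun M h v hhv => by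
        rw [hKhX, if_neg hhv, hoffX, haccX']
      have hKYoff : ∀ M h v, h ≠ v → KhY M h v = if M h = 0 then 0 else (M v : ℝ) / K * min 1 (WY' h / WY' v) := fun M h v hhv => by
        rw [hKhY, if_neg hhv, hoffY, haccY']
      have hKXoff' : ∀ M h v, h ≠ v → KhX M h v = if M h = 0 then 0 else (M v : ℝ) / K * accX' h v := fun M h v hhv => by rw [hKXoff M h v hhv, haccX']
      have hKYoff' : ∀ M h v, h ≠ v → KhY M h v = if M h = 0 then 0 else (M v : ℝ) / K * accY' h v := fun M h v hhv => by rw [hKYoff M h v hhv, haccY']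
      have hKXdiag : ∀ M h, KhX M h h = 1 - ∑ v ∈ univ.erase h, KhX M h v := fun M h => by
        rw [hKhX, if_pos rfl]; congr 1; exact sum_congr rfl fun v hv => by rw [hKhX, if_neg (ne_of_mem_erase hv).symm]
      have hKYdiag : ∀ M h, KhY M h h = 1 - ∑ v ∈ univ.erase h, KhY M h v := fun M h => by
        rw [hKhY, if_pos rfl]; congr 1; exact sum_congr rfl fun v hv => by rw [hKhY, if_neg (ne_of_mem_erase hv).symm]
      have hPX : ∀ h v, PX h v = KhX N' h v := tagged_kernel_eq hacc hPXoff hPXin hPXdiag hPXout hPXstay hN' hWX' hKXoff hKXdiag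
      have hPY : ∀ h v, PY h v = KhY N' h v := tagged_kernel_eq hacc hPYoff hPYin hPYdiag hPYout hPYstay hN' hWY' hKYoff hKYdiag
      let KhnX : ℕ → Option S → Option S → ℝ := fun n =>
        Nat.rec (motive := fun _ => Option S → Option S → ℝ) (fun h v => if h = v then 1 else 0) (fun _ prev h v => ∑ w', prev h w' * KhX N' w' v) n
      let KhnY : ℕ → Option S → Option S → ℝ := fun n =>
        Nat.rec (motive := fun _ => Option S → Option S → ℝ) (fun h v => if h = v then 1 else 0) (fun _ prev h v => ∑ w', prev h w' * KhY N' w' v) n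
      have hKhnX0 : ∀ h v, KhnX 0 h v = if h = v then 1 else 0 := fun _ _ => rfl
      have hKhnXs : ∀ n h v, KhnX (n + 1) h v = ∑ w', KhnX n h w' * KhX N' w' v := fun _ _ _ => rfl
      have hKhnY0 : ∀ h v, KhnY 0 h v = if h = v then 1 else 0 := fun _ _ => rfl
      have hKhnYs : ∀ n h v, KhnY (n + 1) h v = ∑ w', KhnY n h w' * KhY N' w' v := fun _ _ _ => rfl
      have hxrow : ∀ n v, x n v = KhnX n (some z) v := by
        intro n; induction n with
        | zero => intro v; rw [hx0, hKhnX0]; by_cases h : v = some z <;> simp [h, eq_comm]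
        | succ n ih => intro v; rw [hxs, hKhnXs]; exact sum_congr rfl fun h _ => by rw [ih, hPX]
      have hyrow : ∀ n v, y n v = KhnY n (some z) v := by
        intro n; induction n with
        | zero => intro v; rw [hy0, hKhnY0]; by_cases h : v = some z <;> simp [h, eq_comm]
        | succ n ih => intro v; rw [hys, hKhnYs]; exact sum_congr rfl fun h _ => by rw [ih, hPY]
      -- the hypotheses of file 4 (no betweenness proviso)
      have hWXpos : ∀ o, 0 < WX' o := fun o => by rw [hWX']; rcases o with _ | v <;> simp [hW]
      have hWYpos : ∀ o, 0 < WY' o := fun o => by rw [hWY']; rcases o with _ | v <;> simp [hW]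
      have hagree : ∀ o, o ≠ none → WX' o = WY' o := fun o ho => by
        rcases o with _ | v
        · exact absurd rfl ho
        · rw [hWX', hWY']; rfl
      have hWt : WY' none ≤ WX' none := by rw [hWX', hWY']; exact hab
      have hNK : ∑ o, (N' o : ℝ) = K + 1 := by
        have h1 : ∑ o, (N' o : ℝ) = 1 + ∑ v, (NC v : ℝ) := by rw [Fintype.sum_option]; simp [hN', Option.elim]
        have h2 : ∑ v, (NC v : ℝ) = K := by exact_mod_cast hNC
        rw [h1, h2]; ring
      have hNt : N' none = 1 := by rw [hN']; simp
      have hzN : N' (some z) ≠ 0 := by rw [hN']; exact hz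
      have hzt : (some z : Option S) ≠ none := Option.some_ne_none z
      have hza' : WX' none ≤ WX' (some z) := by rw [hWX', hWX']; exact haz
      have hWt' : WY' none < WX' none := by rw [hWX', hWY']; exact hba
      obtain ⟨hC, hB, hO⟩ := hubClass_global_startClass_above hK hNK hNt hWXpos hWYpos hagree hWt' haccX' haccY' hKXoff' hKXdiag hKYoff' hKYdiag
        hKhnX0 hKhnXs hKhnY0 hKhnYs hzN hzt hza'
      refine ⟨fun hw n => ?_, fun n => ?_, ?_⟩
      · have hw' : 2 ≤ N' (some z) ∨ ∃ o, o ≠ some z ∧ o ≠ none ∧ N' o ≠ 0 ∧ WX' none ≤ WX' o := by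
          rcases hw with h2 | ⟨w, hwz, hw, hle⟩
          · left; rw [hN']; exact h2
          · right
            refine ⟨some w, fun h => hwz (Option.some_inj.mp h), Option.some_ne_none w, by rw [hN']; exact hw, ?_⟩
            rw [hWX', hWX']; exact hle
        have h := hC hw' n
        rw [hxrow, hyrow]; exact h
      · have h := hB n
        rw [hxrow, hyrow]; exact h
      · rw [hxrow, hyrow]; exact hO
  obtain ⟨hC, hB, hO⟩ := main
  refine ⟨hC, hB, hO, fun σ hσ0 hσ1 J => ?_⟩
  -- the discounted budget: no deficit at the first attempt, `Even n ∧ n ≠ 0` afterwards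
  set c : ℝ := 1 / (K : ℝ) with hc
  have hc0 : 0 ≤ c := by rw [hc]; positivity
  have hc2 : c ≤ 1 / 2 := by rw [hc]; exact one_div_le_one_div_of_le (by norm_num) hK2
  have hσc0 : 0 ≤ σ * c := mul_nonneg hσ0 hc0
  have hσc : σ * c < 1 := by nlinarith
  have hterm : ∀ n, max 0 (y (n + 1) (some z) - x (n + 1) (some z)) ≤ (if Even n ∧ n ≠ 0 then (c / 2) * c ^ n else 0) := by
    intro n
    by_cases hn0 : n = 0
    · subst hn0
      rw [if_neg (by simp)]
      exact max_le le_rfl (by linarith [hO])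
    · have h := hB n
      rcases Nat.even_or_odd n with he | ho
      · rw [if_pos ⟨he, hn0⟩]
        rw [if_pos he] at h
        refine max_le (mul_nonneg (by positivity) (pow_nonneg hc0 n)) (h.trans (le_of_eq ?_))
        rw [hc, pow_succ]; ring
      · rw [if_neg (fun h' => (Nat.not_even_iff_odd.mpr ho) h'.1)]
        rw [if_neg (Nat.not_even_iff_odd.mpr ho)] at h
        exact max_le le_rfl h
  have hsum : ∑ n ∈ range J, σ ^ n * (if Even n ∧ n ≠ 0 then (c / 2) * c ^ n else 0) ≤ (c / 2) * ((σ * c) ^ 2 / (1 - (σ * c) ^ 2)) := by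
    have e : ∑ n ∈ range J, σ ^ n * (if Even n ∧ n ≠ 0 then (c / 2) * c ^ n else 0) = (c / 2) * ∑ n ∈ range J, (if Even n ∧ n ≠ 0 then (σ * c) ^ n else 0) := by
      rw [mul_sum]
      refine sum_congr rfl fun n _ => ?_
      split_ifs
      · rw [mul_pow]; ring
      · ring
    rw [e]
    exact mul_le_mul_of_nonneg_left (budget_evenPos_le hσc0 hσc J) (by positivity)
  calc ∑ n ∈ range J, (1 - σ) * σ ^ n * max 0 (y (n + 1) (some z) - x (n + 1) (some z))
      ≤ ∑ n ∈ range J, (1 - σ) * (σ ^ n * (if Even n ∧ n ≠ 0 then (c / 2) * c ^ n else 0)) := by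
        refine sum_le_sum fun n _ => ?_
        rw [mul_assoc]
        exact mul_le_mul_of_nonneg_left (mul_le_mul_of_nonneg_left (hterm n) (pow_nonneg hσ0 n)) (by linarith)
    _ = (1 - σ) * ∑ n ∈ range J, σ ^ n * (if Even n ∧ n ≠ 0 then (c / 2) * c ^ n else 0) := by rw [mul_sum]
    _ ≤ (1 - σ) * ((c / 2) * ((σ * c) ^ 2 / (1 - (σ * c) ^ 2))) := mul_le_mul_of_nonneg_left hsum (by linarith)
    _ = (1 - σ) * ((1 : ℝ) / (1 + 1) * (1 / (K : ℝ)) * ((σ * (1 / (K : ℝ))) ^ 2 / (1 - (σ * (1 / (K : ℝ))) ^ 2))) := by rw [hc]; ring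

end TaggedAbove

end Summit.Ventures.LatticeQCDFlow.Scaling
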